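import Summits.HubbardSuperconductivity.HubbardSuperconductivity.Theorems.NodalWardXYVisonPairCostDefs
import Summits.HubbardSuperconductivity.HubbardSuperconductivity.Theorems.NodalWardXYVisonPairCostIRDefs
import Summits.HubbardSuperconductivity.HubbardSuperconductivity.Theorems.NodalWardXYVisonPairCostSymbolDefs
import Summits.HubbardSuperconductivity.HubbardSuperconductivity.Theorems.NodalWardXYVisonPairCostGroundEnergyFormula
import Summits.HubbardSuperconductivity.HubbardSuperconductivity.Theorems.NodalWardXYVisonPairCostLogDetFormula
import Summits.HubbardSuperconductivity.HubbardSuperconductivity.Theorems.NodalWardXYVisonPairCostUltraviolet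
import Summits.HubbardSuperconductivity.HubbardSuperconductivity.Theorems.NodalWardXYVisonPairCostRankWindow
import Summits.HubbardSuperconductivity.HubbardSuperconductivity.Theorems.NodalWardXYVisonPairCostGaugeMirror
import Summits.HubbardSuperconductivity.HubbardSuperconductivity.Theorems.NodalWardXYVisonPairCostGlue
import Summits.HubbardSuperconductivity.HubbardSuperconductivity.Theorems.NodalWardXYVisonPairCostTwoSidedLogDet
import Summits.HubbardSuperconductivity.HubbardSuperconductivity.Theorems.NodalWardXYVisonPairCostMirrorSetup
import Summits.HubbardSuperconductivity.HubbardSuperconductivity.Theorems.NodalWardXYVisonPairCostResolventBound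
import Summits.HubbardSuperconductivity.HubbardSuperconductivity.Theorems.NodalWardXYVisonPairCostMirrorReduction
import Summits.HubbardSuperconductivity.HubbardSuperconductivity.Theorems.NodalWardXYVisonPairCostFreeResolventDecay
import Summits.HubbardSuperconductivity.HubbardSuperconductivity.Theorems.NodalWardXYVisonPairCostIRAssembly
import Summits.HubbardSuperconductivity.HubbardSuperconductivity.Theorems.NodalWardXYVisonPairCostSymbDerivBounds
import Summits.HubbardSuperconductivity.HubbardSuperconductivity.Theorems.NodalWardXYVisonPairCostLineIntegralBounds
import Summits.HubbardSuperconductivity.HubbardSuperconductivity.Theorems.NodalWardXYVisonPairCostGridSumBounds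
import Summits.HubbardSuperconductivity.HubbardSuperconductivity.Theorems.NodalWardXYVisonPairCostSymbolAssembly

/-!
# `VisonPairCost` (crux of route `NodalWardXY`, item stmt-HubbardSuperconductivity-1266): the closing theorem

**Theorem** (`visonPairCost_proof`).  For the lattice `d_{x²−y²}` BdG reference Hamiltonian on the fermionic torus
`(ℤ/Lℤ)²` (hopping `1`, chemical potential `μ ∈ (−4,4) ∖ {0}`, bond gap `Δ₀ > 0`) a PAIR OF Z₂ FLUXES (visons, the `π`
Aharonov–Bohm flux Bogoliubov quasiparticles see around an `hc/2e` vortex) — the string `s_R = −1` on the `R` vertical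
bonds leaving `(a,0)`, `a < R` — changes the many-body ground-state energy by at most `C(μ,Δ₀)`, uniformly in the side
`L ≥ 4` and the separation `R ≤ L/2`:  `|E₀(H_R) − E₀(H_0)| ≤ C`.

**Proof** (line `Sketch`, log-determinant transfer; all pieces are separate `Theorems` files of this directory, composed
here by `stub_glue` and `stub_irAssembly`):
1. `GroundEnergyFormula` — Lieb's partial particle–hole transformation makes `H_R` a free Fermi gas, so
   `E₀(H_R) = −μL² − ½ Σᵢ|λᵢ(N_R)|` with the `2L² × 2L²` one-body Nambu matrix `N_R` (`groundEnergy_bdgBondHamiltonian`);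
2. `LogDetFormula` — Matsubara/Krein: `Σ|λ(A)| − Σ|λ(B)| = (2/π)∫₀^∞ D_t dt`, `D_t = log‖det(A+it)‖ − log‖det(B+it)‖`;
3. `RankWindow` (`t ≤ 1/L`): `rank(N_R − N₀) ≤ 4R` and eigenvalue counting give `|D_t − D_{1/L}| ≤ 8R log(1/(tL))`, whose
   integral is `8R/L ≤ 4`;
4. `Ultraviolet` (`t ≥ t₀`): `|D_t| ≤ C/t²` by moment locality (`Tr N_R^{2k} − Tr N₀^{2k}` is local at the two visons);
5. `InfraredWindow` (`1/L ≤ t ≤ t₀`): the exact GAUGE-MIRROR identity pairs the string with its coboundary complement and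
   leaves `2D_t = log‖det(1 + X₁X₂)‖` with crossing blocks built from FREE resolvents only; a two-sided log-determinant
   estimate (Schur's inequality) bounds `|D_t|` by the crossing Hilbert–Schmidt sum `S(t)` and `S(t)²(1 + |log t|)`;
   periodic summation by parts in one momentum bounds the free torus resolvent by grid-line integrals of the derivatives of
   the explicit `d`-wave symbol, and the nodal analysis of those integrals (`Φ₁ ≲ 1 + |log t|`, `Φ₂ ≲ 1/t`) makes
   `S(t) ≲ (1+|log t|)² t^{−1/4} + (tL)^{−2}`, integrable on `(0, t₀]` uniformly in `L` and `R`.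

No hypothesis beyond the item's; axioms `propext`, `Classical.choice`, `Quot.sound`.
-/

noncomputable section

-- tree namespace Summit.HubbardSuperconductivity.HubbardSuperconductivity (D-0017)
set_option linter.dupNamespace false

namespace Summit.HubbardSuperconductivity.HubbardSuperconductivity.Theorems.VisonPairCost

/-- The nodal symbol bounds (assembled from the derivative, line-integral and grid-sum estimates). -/
theorem symbolIntegralBounds_holds : SymbolIntegralBounds :=
  stub_symbolAssembly stub_symbDerivBounds stub_lineIntegralBounds stub_gridSumBounds

/-- The infrared window `∫_{1/L}^{t₀}|D_t| dt + L⁻¹|D_{1/L}| ≤ C(μ,Δ₀,t₀)`. -/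
theorem infraredWindow_holds : InfraredWindow :=
  stub_irAssembly
    (stub_mirrorReduction stub_gaugeMirror stub_twoSidedLogDet stub_mirrorSetup
      (stub_resolventBound stub_mirrorSetup))
    stub_freeResolventDecay symbolIntegralBounds_holds

/-- The body of the crux over `visonH`. -/
theorem cruxBound_holds : CruxBound :=
  stub_glue stub_groundEnergyFormula stub_logDetFormula stub_ultraviolet stub_rankWindow infraredWindow_holds

/-- **`VisonPairCost`** (route `NodalWardXY`, crux rank 2, item stmt-HubbardSuperconductivity-1266): the two-vison
cost of the lattice nodal `d`-wave BdG Hamiltonian is bounded uniformly in `L ≥ 4` and `2R ≤ L`. -/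
theorem visonPairCost_proof :
    Summit.HubbardSuperconductivity.HubbardSuperconductivity.Theses.NodalWardXY.VisonPairCost :=
  visonPairCost_of_cruxBound cruxBound_holds

end Summit.HubbardSuperconductivity.HubbardSuperconductivity.Theorems.VisonPairCost

end
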